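import Mathlib.Analysis.Normed.Operator.Compact.FredholmAlternative
import Mathlib.Analysis.Normed.Operator.Banach
import Mathlib.Topology.Algebra.Module.FiniteDimension
import Literature.Analysis.Calculus.BorderedImplicitFunction
import HarnessLib

/-!
# Bordered compact perturbations of a bordered isomorphism (automatic transversality,
# abstract part)

Analysis/Calculus file (Mathlib + `BorderedImplicitFunction` only).  The elementary functional
analysis behind "automatic transversality" for the linearised Cauchy–Riemann operator on a
trivial line bundle over the sphere (Hofer–Lizan–Sikorav 1997; Wendl 2018, Thm. 2.46 and
Prop. 2.53): let `D, A : E₁ → E₀` be bounded operators of real Banach spaces and `ℓ : E₁ → G` a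
bounded surjection onto a normed space (the "border", e.g. evaluation at a point).  Suppose

* `D` restricted to `W := ker ℓ` is a bijection onto `E₀` (e.g. `∂̄` on functions vanishing at a
  point, by Dolbeault / Liouville),
* `A` is a compact operator (a zeroth-order term, compact by Rellich / Arzelà–Ascoli),
* `D + A` is injective on `W` (the similarity principle: kernel elements have isolated zeros).

Then (`bijective_prod_of_isCompactOperator`) the BORDERED operator `x ↦ ((D + A) x, ℓ x)` is a
bijection `E₁ → E₀ × G`: indeed `(D + A)|_W` is an injective compact perturbation of the
isomorphism `D|_W : W ≃ E₀`, hence bijective by the Fredholm alternative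
(`bijective_of_injective_of_isCompactOperator`), and one then solves the bordered system by hand.
Consequences: `D + A` is onto (`surjective_add_of_isCompactOperator`), its kernel is a complement
of `ker ℓ` (`isCompl_ker_add_of_isCompactOperator`) on which `ℓ` restricts to a linear bijection
onto `G` (`bijective_ker_add_of_isCompactOperator`), so `dim ker (D + A) = dim G`
(`finrank_ker_add_of_isCompactOperator`, `finiteDimensional_ker_add_of_isCompactOperator`); and
for finite-dimensional `G` the bordered operator is a linear homeomorphism
`borderedEquiv : E₁ ≃L[ℝ] E₀ × G` (Banach open mapping) with inverse `borderedInverse`, the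
right inverse used in the implicit-function-theorem construction of `J`-holomorphic spheres.

Spelling: kernels of continuous linear maps are written `ℓ.ker`, `(D + A).ker`
(`= LinearMap.ker (ℓ : E₁ →ₗ[ℝ] G)`); the hypothesis "`D|_{ker ℓ}` is bijective" is
`Bijective fun x : ℓ.ker => D x`, and the conclusions are stated for the bare function
`fun x => ((D + A) x, ℓ x)` (`= ⇑((D + A).prod ℓ)` definitionally).

Not here: anything about the sphere, Hölder spaces, `∂̄`, or the similarity principle (these are
the hypotheses `hD`, `hA`, `hinj` in the application); the one-parameter method of continuity
(not needed: Riesz theory at `t = 1` suffices).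

## References

* C. Wendl, *Holomorphic Curves in Low Dimensions*, Lecture Notes in Mathematics 2216, Springer
  (2018), Thm. 2.46, Prop. 2.53. [Wendl2018]
* H. Hofer, V. Lizan, J.-C. Sikorav, *On genericity for holomorphic curves in four-dimensional
  almost-complex manifolds*, J. Geom. Anal. 7 (1997) 149–159. [HoferLizanSikorav1997]
-/

noncomputable section

open Function

namespace Literature.Analysis.Calculus

section Bordered

variable {E₁ E₀ G : Type*} [NormedAddCommGroup E₁] [NormedSpace ℝ E₁] [CompleteSpace E₁]
  [NormedAddCommGroup E₀] [NormedSpace ℝ E₀] [CompleteSpace E₀]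
  [NormedAddCommGroup G] [NormedSpace ℝ G]

/-- **Bordered compact perturbation lemma** (automatic transversality, abstract part; real Banach
spaces `E₁, E₀`, normed space `G`).  Let `D, A : E₁ →L E₀`, `ℓ : E₁ →L G` surjective, `D|_{ker ℓ}`
a bijection onto `E₀`, `A` compact and `D + A` injective on `ker ℓ`.  Then the bordered operator
`x ↦ ((D + A) x, ℓ x)` is a bijection `E₁ → E₀ × G`.  (`(D + A)|_{ker ℓ}` is an injective compact
perturbation of the isomorphism `D|_{ker ℓ}`, hence bijective by the Fredholm alternative; then
solve: given `(y, g)` pick `ℓ x₁ = g` and `w ∈ ker ℓ` with `(D + A) w = y − (D + A) x₁`.) [folklore] -/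
theorem bijective_prod_of_isCompactOperator (D A : E₁ →L[ℝ] E₀) (ℓ : E₁ →L[ℝ] G)
    (hℓ : Surjective ℓ) (hD : Bijective fun x : ℓ.ker => D (x : E₁))
    (hA : IsCompactOperator A) (hinj : ∀ x : E₁, ℓ x = 0 → (D + A) x = 0 → x = 0) :
    Bijective fun x : E₁ => ((D + A) x, ℓ x) := by
  -- `W = ker ℓ` is a closed, hence complete, subspace (`ContinuousLinearMap.completeSpace_ker`);
  -- `T = (D + A)|_W` is a compact perturbation of the isomorphism `J = D|_W : W ≃ E₀`
  set T : ℓ.ker →L[ℝ] E₀ := (D + A) ∘L ℓ.ker.subtypeL with hT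
  have hDb : Bijective (D ∘L ℓ.ker.subtypeL) := hD
  set J : ℓ.ker ≃L[ℝ] E₀ := ContinuousLinearEquiv.ofBijective _
    (LinearMap.ker_eq_bot.2 hDb.1) (LinearMap.range_eq_top.2 hDb.2) with hJ
  have hK : IsCompactOperator
      (T - (J : ℓ.ker →L[ℝ] E₀) : ℓ.ker →L[ℝ] E₀) := by
    have hfun : ((T - (J : ℓ.ker →L[ℝ] E₀) : ℓ.ker →L[ℝ] E₀) :
        ℓ.ker → E₀) = (A ∘L ℓ.ker.subtypeL : ℓ.ker → E₀) := by
      funext x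
      simp [hT, hJ]
    rw [hfun]
    exact hA.comp_clm _
  have hTinj : Injective T := by
    rw [injective_iff_map_eq_zero]
    intro x hx
    exact Subtype.ext (hinj x (ℓ.apply_val_ker x) hx)
  have hTb := bijective_of_injective_of_isCompactOperator T J hK hTinj
  refine ⟨fun x y hxy => ?_, ?_⟩
  · simp only [Prod.mk.injEq] at hxy
    rw [← sub_eq_zero]
    refine hinj _ ?_ ?_
    · rw [map_sub, hxy.2, sub_self]
    · rw [map_sub, hxy.1, sub_self]
  · rintro ⟨y, g⟩
    obtain ⟨x₁, hx₁⟩ := hℓ g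
    obtain ⟨w, hw⟩ := hTb.2 (y - (D + A) x₁)
    have hw' : (D + A) (w : E₁) = y - (D + A) x₁ := hw
    have hℓw : ℓ (w : E₁) = 0 := ℓ.apply_val_ker w
    refine ⟨x₁ + w, ?_⟩
    simp only [map_add, hw', hx₁, hℓw, add_zero, Prod.mk.injEq, and_true]
    abel

/-- Under the hypotheses of `bijective_prod_of_isCompactOperator`, the perturbed operator `D + A`
is onto `E₀` (automatic transversality: surjectivity of the linearised operator). [folklore] -/
theorem surjective_add_of_isCompactOperator (D A : E₁ →L[ℝ] E₀) (ℓ : E₁ →L[ℝ] G)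
    (hℓ : Surjective ℓ) (hD : Bijective fun x : ℓ.ker => D (x : E₁))
    (hA : IsCompactOperator A) (hinj : ∀ x : E₁, ℓ x = 0 → (D + A) x = 0 → x = 0) :
    Surjective (D + A) := fun y => by
  obtain ⟨x, hx⟩ := (bijective_prod_of_isCompactOperator D A ℓ hℓ hD hA hinj).2 (y, 0)
  exact ⟨x, congrArg Prod.fst hx⟩

/-- Under the hypotheses of `bijective_prod_of_isCompactOperator`, `ker (D + A)` and `ker ℓ` are
complementary subspaces of `E₁`. [folklore] -/
theorem isCompl_ker_add_of_isCompactOperator (D A : E₁ →L[ℝ] E₀) (ℓ : E₁ →L[ℝ] G)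
    (hℓ : Surjective ℓ) (hD : Bijective fun x : ℓ.ker => D (x : E₁))
    (hA : IsCompactOperator A) (hinj : ∀ x : E₁, ℓ x = 0 → (D + A) x = 0 → x = 0) :
    IsCompl (D + A).ker ℓ.ker := by
  have hb := bijective_prod_of_isCompactOperator D A ℓ hℓ hD hA hinj
  refine IsCompl.of_eq ?_ ?_
  · rw [Submodule.eq_bot_iff]
    intro x hx
    rw [Submodule.mem_inf] at hx
    exact hinj x (ℓ.apply_val_ker ⟨x, hx.2⟩) ((D + A).apply_val_ker ⟨x, hx.1⟩)
  · rw [Submodule.eq_top_iff']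
    intro x
    obtain ⟨x', hx'⟩ := hb.2 ((D + A) x, 0)
    have h1 : (D + A) x' = (D + A) x := congrArg Prod.fst hx'
    have h2 : ℓ x' = 0 := congrArg Prod.snd hx'
    rw [Submodule.mem_sup]
    have h3 : (D + A) (x - x') = 0 := by rw [map_sub, h1, sub_self]
    exact ⟨x - x', h3, x', h2, sub_add_cancel x x'⟩

/-- Under the hypotheses of `bijective_prod_of_isCompactOperator`, the border map `ℓ` restricts to
a linear bijection `ker (D + A) → G`. [folklore] -/
theorem bijective_ker_add_of_isCompactOperator (D A : E₁ →L[ℝ] E₀) (ℓ : E₁ →L[ℝ] G)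
    (hℓ : Surjective ℓ) (hD : Bijective fun x : ℓ.ker => D (x : E₁))
    (hA : IsCompactOperator A) (hinj : ∀ x : E₁, ℓ x = 0 → (D + A) x = 0 → x = 0) :
    Bijective fun u : (D + A).ker => ℓ (u : E₁) := by
  have hb := bijective_prod_of_isCompactOperator D A ℓ hℓ hD hA hinj
  refine ⟨fun u v huv => ?_, fun g => ?_⟩
  · apply Subtype.ext
    rw [← sub_eq_zero]
    refine hinj _ ?_ ?_
    · rw [map_sub, sub_eq_zero]
      exact huv
    · rw [map_sub, (D + A).apply_val_ker u, (D + A).apply_val_ker v, sub_self]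
  · obtain ⟨x, hx⟩ := hb.2 (0, g)
    have h1 : (D + A) x = 0 := congrArg Prod.fst hx
    have h2 : ℓ x = g := congrArg Prod.snd hx
    exact ⟨⟨x, h1⟩, h2⟩

/-- Under the hypotheses of `bijective_prod_of_isCompactOperator`, `dim ker (D + A) = dim G`
(`Module.finrank`; both sides are `0` if `G` is infinite-dimensional).  In the application
(`G = ℂ`, `ℓ` = evaluation at a point) the kernel of the linearised operator is `2`-dimensional.
[folklore] -/
theorem finrank_ker_add_of_isCompactOperator (D A : E₁ →L[ℝ] E₀) (ℓ : E₁ →L[ℝ] G)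
    (hℓ : Surjective ℓ) (hD : Bijective fun x : ℓ.ker => D (x : E₁))
    (hA : IsCompactOperator A) (hinj : ∀ x : E₁, ℓ x = 0 → (D + A) x = 0 → x = 0) :
    Module.finrank ℝ ((D + A).ker) = Module.finrank ℝ G :=
  (LinearEquiv.ofBijective ((ℓ : E₁ →ₗ[ℝ] G).domRestrict (D + A).ker)
    (bijective_ker_add_of_isCompactOperator D A ℓ hℓ hD hA hinj)).finrank_eq

/-- Under the hypotheses of `bijective_prod_of_isCompactOperator` with `G` finite-dimensional,
`ker (D + A)` is finite-dimensional. [folklore] -/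
theorem finiteDimensional_ker_add_of_isCompactOperator [FiniteDimensional ℝ G]
    (D A : E₁ →L[ℝ] E₀) (ℓ : E₁ →L[ℝ] G)
    (hℓ : Surjective ℓ) (hD : Bijective fun x : ℓ.ker => D (x : E₁))
    (hA : IsCompactOperator A) (hinj : ∀ x : E₁, ℓ x = 0 → (D + A) x = 0 → x = 0) :
    FiniteDimensional ℝ ((D + A).ker) :=
  (LinearEquiv.ofBijective ((ℓ : E₁ →ₗ[ℝ] G).domRestrict (D + A).ker)
    (bijective_ker_add_of_isCompactOperator D A ℓ hℓ hD hA hinj)).symm.finiteDimensional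

/-- **The bordered isomorphism.**  Under the hypotheses of `bijective_prod_of_isCompactOperator`
with `G` finite-dimensional (hence complete), the bordered operator `x ↦ ((D + A) x, ℓ x)` as a
linear homeomorphism `E₁ ≃L[ℝ] E₀ × G` (Banach open mapping theorem). [folklore] -/
def borderedEquiv [FiniteDimensional ℝ G] (D A : E₁ →L[ℝ] E₀) (ℓ : E₁ →L[ℝ] G)
    (hℓ : Surjective ℓ) (hD : Bijective fun x : ℓ.ker => D (x : E₁))
    (hA : IsCompactOperator A) (hinj : ∀ x : E₁, ℓ x = 0 → (D + A) x = 0 → x = 0) :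
    E₁ ≃L[ℝ] E₀ × G :=
  haveI : CompleteSpace G := FiniteDimensional.complete ℝ G
  ContinuousLinearEquiv.ofBijective ((D + A).prod ℓ)
    (LinearMap.ker_eq_bot.2 (bijective_prod_of_isCompactOperator D A ℓ hℓ hD hA hinj).1)
    (LinearMap.range_eq_top.2 (bijective_prod_of_isCompactOperator D A ℓ hℓ hD hA hinj).2)

/-- `borderedEquiv` is the bordered operator `x ↦ ((D + A) x, ℓ x)`. [folklore] -/
@[simp]
theorem borderedEquiv_apply [FiniteDimensional ℝ G] (D A : E₁ →L[ℝ] E₀) (ℓ : E₁ →L[ℝ] G)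
    (hℓ : Surjective ℓ) (hD : Bijective fun x : ℓ.ker => D (x : E₁))
    (hA : IsCompactOperator A) (hinj : ∀ x : E₁, ℓ x = 0 → (D + A) x = 0 → x = 0) (x : E₁) :
    borderedEquiv D A ℓ hℓ hD hA hinj x = ((D + A) x, ℓ x) :=
  rfl

/-- `borderedEquiv` as a continuous linear map is `(D + A).prod ℓ`. [folklore] -/
theorem coe_borderedEquiv [FiniteDimensional ℝ G] (D A : E₁ →L[ℝ] E₀) (ℓ : E₁ →L[ℝ] G)
    (hℓ : Surjective ℓ) (hD : Bijective fun x : ℓ.ker => D (x : E₁))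
    (hA : IsCompactOperator A) (hinj : ∀ x : E₁, ℓ x = 0 → (D + A) x = 0 → x = 0) :
    (borderedEquiv D A ℓ hℓ hD hA hinj : E₁ →L[ℝ] E₀ × G) = (D + A).prod ℓ := by
  ext x <;> rfl

/-- **The bordered inverse** `(E₀ × G) ≃L[ℝ] E₁`: the inverse of the bordered isomorphism
`borderedEquiv`, i.e. `(y, g) ↦` the unique `x` with `(D + A) x = y`, `ℓ x = g` (a bounded right
inverse of `D + A` normalised by the border condition). [folklore] -/
def borderedInverse [FiniteDimensional ℝ G] (D A : E₁ →L[ℝ] E₀) (ℓ : E₁ →L[ℝ] G)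
    (hℓ : Surjective ℓ) (hD : Bijective fun x : ℓ.ker => D (x : E₁))
    (hA : IsCompactOperator A) (hinj : ∀ x : E₁, ℓ x = 0 → (D + A) x = 0 → x = 0) :
    (E₀ × G) ≃L[ℝ] E₁ :=
  (borderedEquiv D A ℓ hℓ hD hA hinj).symm

/-- `borderedInverse (y, g)` solves the bordered system: `(D + A) x = y` and `ℓ x = g`.
[folklore] -/
theorem borderedInverse_apply_eq [FiniteDimensional ℝ G] (D A : E₁ →L[ℝ] E₀) (ℓ : E₁ →L[ℝ] G)
    (hℓ : Surjective ℓ) (hD : Bijective fun x : ℓ.ker => D (x : E₁))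
    (hA : IsCompactOperator A) (hinj : ∀ x : E₁, ℓ x = 0 → (D + A) x = 0 → x = 0)
    (y : E₀) (g : G) :
    (D + A) (borderedInverse D A ℓ hℓ hD hA hinj (y, g)) = y ∧
      ℓ (borderedInverse D A ℓ hℓ hD hA hinj (y, g)) = g := by
  have h := (borderedEquiv D A ℓ hℓ hD hA hinj).apply_symm_apply (y, g)
  rw [borderedEquiv_apply, Prod.mk.injEq] at h
  exact h

/-- `borderedInverse` is a left inverse of the bordered operator:
`borderedInverse ((D + A) x, ℓ x) = x`. [folklore] -/
@[simp]
theorem borderedInverse_apply_prod [FiniteDimensional ℝ G] (D A : E₁ →L[ℝ] E₀) (ℓ : E₁ →L[ℝ] G)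
    (hℓ : Surjective ℓ) (hD : Bijective fun x : ℓ.ker => D (x : E₁))
    (hA : IsCompactOperator A) (hinj : ∀ x : E₁, ℓ x = 0 → (D + A) x = 0 → x = 0) (x : E₁) :
    borderedInverse D A ℓ hℓ hD hA hinj ((D + A) x, ℓ x) = x := by
  have h := (borderedEquiv D A ℓ hℓ hD hA hinj).symm_apply_apply x
  rwa [borderedEquiv_apply] at h

/-- The bordered operator followed by `borderedInverse` is the identity on `E₀ × G`:
`((D + A) (borderedInverse p), ℓ (borderedInverse p)) = p`. [folklore] -/
@[simp]
theorem prod_borderedInverse_apply [FiniteDimensional ℝ G] (D A : E₁ →L[ℝ] E₀) (ℓ : E₁ →L[ℝ] G)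
    (hℓ : Surjective ℓ) (hD : Bijective fun x : ℓ.ker => D (x : E₁))
    (hA : IsCompactOperator A) (hinj : ∀ x : E₁, ℓ x = 0 → (D + A) x = 0 → x = 0) (p : E₀ × G) :
    ((D + A) (borderedInverse D A ℓ hℓ hD hA hinj p), ℓ (borderedInverse D A ℓ hℓ hD hA hinj p)) = p := by
  have h := (borderedEquiv D A ℓ hℓ hD hA hinj).apply_symm_apply p
  rwa [borderedEquiv_apply] at h

end Bordered

end Literature.Analysis.Calculus

end
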